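import Summits.HodgeConjecture.HodgeConjecture.Theorems.HolomorphicityRateSuperThresholdRigidityGoodPointRegular
import Summits.HodgeConjecture.HodgeConjecture.Theorems.HolomorphicityRateSuperThresholdRigidityAnalyticOfRegularOffBad
import Literature.Geometry.Kaehler.NearlyHolomorphicCycleSupport
import Literature.AlgebraicGeometry.HodgeTheory.RationalHodgeClasses
import HarnessLib

/-!
# Route `HolomorphicityRate`, crux `SuperThresholdRigidity` (stmt-HodgeConjecture-2737) — recognition of holomorphic supports

The recognition half of the crux skeleton `Cruxes/SuperThresholdRigidity/Lines/birth.lean`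
(line `registered`), now sorry-free: the `C¹` case of King / Harvey–Shiffman.

* `isAnalyticSet_of_holomorphicSupport` — on a complex manifold `M` charted on `E ≅ ℂⁿ`: a closed
  `S` which, off a closed `Sg ⊆ S` near which `S` is analytic and which lies in a closed analytic
  set all of whose regular points have codimension `≥ p + 1`, is locally the zero set of a real
  `C¹` submersion `f : M → ℝ^{2p}` with `J`-stable kernel at the base point, IS a closed analytic
  subset of `M` all of whose regular points have codimension `≥ p` (composition of the landed
  pieces `stub_goodPointRegular` and `stub_analyticOfRegularOffBad`).
* `stub_holomorphicSupportIsAnalytic` — the planner's stub 2 of the birth skeleton, signature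
  verbatim (the same statement on the carrier of a Hodge model).
* `IsNearlyHolomorphicCycleSupport.isAnalyticSet_of_defect_zero` — **a nearly holomorphic cycle
  support of defect `0` is an analytic subset with regular points of codimension `≥ p`**: the
  converse regularity statement listed as "NOT here" in
  `Literature/Geometry/Kaehler/NearlyHolomorphicCycleSupport.lean` (defect `0` means `J`-stable
  tangent spaces, `hasJDefectLE_zero_iff`). In particular the crux `SuperThresholdRigidity` holds
  outright for representatives of defect exactly `0` (`C' = 0`); what remains of the crux is the
  Newton–Kuranishi correction from defect `o(k^{-p})` to defect `0` (stub `stub_newtonBelowThreshold`).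

## References

* J. R. King, *The currents defined by analytic varieties*, Acta Math. 127 (1971) [King1971].
* R. Harvey, B. Shiffman, *A characterization of holomorphic chains*, Ann. of Math. 99 (1974)
  [HarveyShiffman1974].
* E. M. Chirka, *Complex Analytic Sets*, Kluwer (1989), §2.3, §5.2 [Chirka1989].
-/

-- the problem path `HodgeConjecture/HodgeConjecture` (single-problem summit) repeats a namespace segment
set_option linter.dupNamespace false

open scoped Manifold Topology ContDiff
open Set

namespace Summit.HodgeConjecture.HodgeConjecture.Theorems

/-- **Recognition of holomorphic supports (the `C¹` case of King / Harvey–Shiffman).** On a complex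
manifold `M` charted on the finite-dimensional complex space `E` (holomorphic atlas, real `C^∞`
atlas): let `S` be closed, `Sg ⊆ S` closed, `S` analytic at every point of `Sg`, `Sg` contained in a
closed analytic set all of whose regular points have codimension `≥ p + 1`, and suppose every
`x ∈ S ∖ Sg` has an open `U ∋ x` and a real `C¹` map `f : M → ℝ^{2p}` on `U` with
`S ∩ U = U ∩ f⁻¹(0)`, `df_x` onto and `ker df_x` stable under `J = tangentJ E x`. Then `S` is an
analytic subset of `M` and every regular point of `S` has codimension `≥ p`.
[King1971; HarveyShiffman1974; Chirka1989, §2.3 and §5.2 Thm. 2] [folklore] -/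
theorem isAnalyticSet_of_holomorphicSupport {E : Type*} [NormedAddCommGroup E] [NormedSpace ℂ E]
    [FiniteDimensional ℂ E] {M : Type*} [TopologicalSpace M] [ChartedSpace E M]
    [IsManifold 𝓘(ℂ, E) ω M] [IsManifold 𝓘(ℝ, E) ∞ M] {p : ℕ} {S Sg : Set M}
    (hS : IsClosed S) (hSg : IsClosed Sg) (hsub : Sg ⊆ S)
    (han : ∀ x ∈ Sg, Literature.Geometry.Kaehler.IsAnalyticSetAt 𝓘(ℂ, E) S x)
    (hT : ∃ T : Set M, Sg ⊆ T ∧ (Literature.Geometry.Kaehler.IsAnalyticSet 𝓘(ℂ, E) T ∧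
      ∀ x ∈ Literature.Geometry.Kaehler.regularLocus 𝓘(ℂ, E) T, ∀ q : ℕ,
        Literature.Geometry.Kaehler.IsRegularPointOfCodim 𝓘(ℂ, E) T q x → p + 1 ≤ q))
    (hgood : ∀ x ∈ S \ Sg, ∃ U : Set M, IsOpen U ∧ x ∈ U ∧ ∃ f : M → (Fin (2 * p) → ℝ),
      ContMDiffOn 𝓘(ℝ, E) 𝓘(ℝ, Fin (2 * p) → ℝ) 1 f U ∧ S ∩ U = U ∩ f ⁻¹' {0} ∧
        Function.Surjective (mfderiv 𝓘(ℝ, E) 𝓘(ℝ, Fin (2 * p) → ℝ) f x) ∧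
          ∀ v : TangentSpace 𝓘(ℝ, E) x, mfderiv 𝓘(ℝ, E) 𝓘(ℝ, Fin (2 * p) → ℝ) f x v = 0 →
            mfderiv 𝓘(ℝ, E) 𝓘(ℝ, Fin (2 * p) → ℝ) f x
              (Literature.Geometry.Kaehler.tangentJ E x v) = 0) :
    Literature.Geometry.Kaehler.IsAnalyticSet 𝓘(ℂ, E) S ∧
      ∀ x ∈ Literature.Geometry.Kaehler.regularLocus 𝓘(ℂ, E) S, ∀ q : ℕ,
        Literature.Geometry.Kaehler.IsRegularPointOfCodim 𝓘(ℂ, E) S q x → p ≤ q :=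
  stub_analyticOfRegularOffBad hS hSg hsub han hT (stub_goodPointRegular hSg hgood)

/-- **The planner's stub 2 of the birth skeleton, signature verbatim** (recognition of holomorphic
supports on the carrier of a Hodge model `A` of a smooth `ℂ`-scheme: a complex manifold with
holomorphic atlas on the finite-dimensional model `A.model`). Immediate from
`isAnalyticSet_of_holomorphicSupport`. [King1971; HarveyShiffman1974; Chirka1989, §2.3]
[folklore] -/
theorem stub_holomorphicSupportIsAnalytic : ∀ (n : ℕ) (X : Literature.AlgebraicGeometry.Motives.SchemeOver ℂ) (A : Literature.AlgebraicGeometry.HodgeTheory.HodgeModel n X) (p : ℕ) (S Sg : Set A.carrier), (IsClosed S ∧ IsClosed Sg ∧ Sg ⊆ S ∧ (∀ x ∈ Sg, Literature.Geometry.Kaehler.IsAnalyticSetAt 𝓘(ℂ, A.model) S x) ∧ (∃ T : Set A.carrier, Sg ⊆ T ∧ (Literature.Geometry.Kaehler.IsAnalyticSet 𝓘(ℂ, A.model) T ∧ ∀ x ∈ Literature.Geometry.Kaehler.regularLocus 𝓘(ℂ, A.model) T, ∀ q : ℕ, Literature.Geometry.Kaehler.IsRegularPointOfCodim 𝓘(ℂ,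 A.model) T q x → p + 1 ≤ q)) ∧ (∀ x ∈ S \ Sg, ∃ U : Set A.carrier, IsOpen U ∧ x ∈ U ∧ ∃ f : A.carrier → (Fin (2 * p) → ℝ), ContMDiffOn 𝓘(ℝ, A.model) 𝓘(ℝ, Fin (2 * p) → ℝ) 1 f U ∧ S ∩ U = U ∩ f ⁻¹' {0} ∧ Function.Surjective (mfderiv 𝓘(ℝ, A.model) 𝓘(ℝ, Fin (2 * p) → ℝ) f x) ∧ ∀ v : TangentSpace 𝓘(ℝ, A.model) x, mfderiv 𝓘(ℝ, A.model) 𝓘(ℝ, Fin (2 * p) → ℝ) f x v = 0 → mfderiv 𝓘(ℝ, A.model) 𝓘(ℝ, Fin (2 * p) → ℝ) f x (Literature.Geometry.Kaehler.tangentJ A.model x v) = 0)) → (Literature.Geometry.Kaehler.IsAnalyticSet 𝓘(ℂ, A.model) S ∧ ∀ x ∈ Literature.Geometry.Kaehler.regularLocus 𝓘(ℂ, A.model) S, ∀ q : ℕ, Literature.Geometry.Kaehler.IsRegularPointOfCodim 𝓘(ℂ, A.model) S q x → p ≤ q) := by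
  rintro n X A p S Sg ⟨hS, hSg, hsub, han, hT, hgood⟩
  exact isAnalyticSet_of_holomorphicSupport hS hSg hsub han hT hgood

/-- **A nearly holomorphic cycle support of defect `0` is an analytic subset with regular points of
codimension `≥ p`.** For any Riemannian metric `g` on the real tangent bundle of a complex manifold
`M` charted on `E`: if `(S, Sg)` is a nearly holomorphic cycle support of codimension `p` and
defect `≤ 0` (`Literature.Geometry.Kaehler.IsNearlyHolomorphicCycleSupport g p 0 S Sg`: the good
part `S ∖ Sg` is a connected real `C¹` submanifold of codimension `2p` whose tangent spaces are
`J`-stable by `hasJDefectLE_zero_iff`, `S` is analytic near the closed bad set `Sg`, and `Sg` lies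
in an analytic set of codimension `≥ p + 1`), then `S` is an analytic subset of `M` all of whose
regular points have codimension `≥ p`. This is the converse of
`Literature.Geometry.Kaehler.HasPureCodim.isNearlyHolomorphicCycleSupport` (holomorphic chains have
defect `0`), i.e. the `C¹` case of the King / Harvey–Shiffman characterisation of holomorphic
chains; in the crux `SuperThresholdRigidity` it settles the representatives of defect exactly `0`.
[King1971; HarveyShiffman1974; Chirka1989, §2.3] [folklore] -/
theorem _root_.Literature.Geometry.Kaehler.IsNearlyHolomorphicCycleSupport.isAnalyticSet_of_defect_zero
    {E : Type*} [NormedAddCommGroup E] [NormedSpace ℂ E] [FiniteDimensional ℂ E]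
    {M : Type*} [TopologicalSpace M] [ChartedSpace E M] [IsManifold 𝓘(ℂ, E) ω M]
    [IsManifold 𝓘(ℝ, E) ∞ M]
    {g : Bundle.RiemannianMetric (fun x : M ↦ TangentSpace 𝓘(ℝ, E) x)} {p : ℕ} {S Sg : Set M}
    (h : Literature.Geometry.Kaehler.IsNearlyHolomorphicCycleSupport g p 0 S Sg) :
    Literature.Geometry.Kaehler.IsAnalyticSet 𝓘(ℂ, E) S ∧
      ∀ x ∈ Literature.Geometry.Kaehler.regularLocus 𝓘(ℂ, E) S, ∀ q : ℕ,
        Literature.Geometry.Kaehler.IsRegularPointOfCodim 𝓘(ℂ, E) S q x → p ≤ q := by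
  obtain ⟨hS, hSg, hsub, -, han, hT, hreg⟩ := h
  refine isAnalyticSet_of_holomorphicSupport hS hSg hsub han hT fun x hx => ?_
  obtain ⟨U, hU, hxU, f, hf, hSU, hsurj, hV⟩ := hreg x hx
  refine ⟨U, hU, hxU, f, hf, hSU, hsurj, fun v hv => ?_⟩
  exact (Literature.Geometry.Kaehler.hasJDefectLE_zero_iff.1 hV) v hv

end Summit.HodgeConjecture.HodgeConjecture.Theorems
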